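import Mathlib
import Literature.NumberTheory.EllipticCurves.ProfiniteGroupDistribution

/-!
# STUB-IDEAS k3 (gen 44) — «THE LEVEL DECIDES»: a μ-free, Coleman-free transfer of LOWER's
# value receptacle to ONE twisted elliptic-unit regulator sum at ONE finite level (glue PROVED)

Stub `stub_heegnerIndexLowerAtTwo` (LEAD skeleton `f2bd84c029a8a938`), crux
`PrintCf2.SplitBadTwoLowerHalfOfFacts` (stmt-BirchSwinnertonDyer-27851).  Technique (payload):
«decomposition (split into sub-stubs with a provable glue)», home family 3 (probe the extremes).
Node: STUB-PLAN v7.6 HARDEST (b) in its typed receptacle (critic g43, `critic_g43_junction.lean`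
`56ee6ed970f49825`): deliver `MeasureValue ι v v̄ Sθ (IsCosetValues ι v v̄) r l (‖·‖ ≤ 2^{−M/2})`, i.e.
«for EVERY L-measure witness `μ` at `Sθ` carrying the coset values, `‖∫ r·l dμ‖ ≤ 2^{−M/2}`»; road A′'s
open items there are frame (i-c) and R200′(b″) (smoothing S⁻, Gauss ✓, unit-log column S).

THE CUT (this file = its glue, abstract over a field / an ultrametric normed field, PROVED, no `sorry`):

* §A `norm_integral_le_iff_norm_sum_le` / `norm_integral_le_iff_norm_sampleSum_le` — THE LEVEL DECIDES:
  for a bounded distribution `D` of the tree (`GroupDistribution`), a tower-continuous `F` whose oscillation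
  on the cells of every level `≥ N` is `≤ ε`, ANY sample points `x a ∈ a` (resp. any sample VALUES `y a`
  within `ε` of `F(repr a)` — model: `y a = F(s(π a))` for a section `s` of `Γ_K → Gal(K(𝔤_m)/K)`), and a
  threshold `R ≥ bound·ε`: `‖∫ F dD‖ ≤ R ↔ ‖Σ_a D_n(a)·y a‖ ≤ R` (ultrametric; tree
  `norm_integral_sub_riemannSum_le`).  So the receptacle's `∀ μ`-statement about an INFINITE-order integral
  is decided, witness by witness, by ONE finite sum at level `m₀(M, key)`.
* §B `isotypic_transfer` — THE θ-ISOTYPIC FOURIER TRANSFER (the new lever): on a finite abelian group `G`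
  (model: `Gal(K(𝔣₀v̄^m vⁿ)/K)`) with inertia subgroup `I` and a character `θ` of `I` of the frame's type:
  if `F : G → 𝕜` has `I`-type `θ⁻¹` (`F(hσ) = θ(h)⁻¹F(σ)`) and the masses `ν` satisfy, FOR THE TYPE-θ
  CHARACTERS χ ONLY (exactly what `IsCosetValues` supplies: exact `v`-level `n`, any `v̄`-level),
  `Σ_σ χ(σ)⁻¹ν(σ) = c·χ(γ₀)⁻¹·Σ_g χ(g)L(g)` (II.5.2 (4): `c` = Gauss constant of the type, `L(g) = log j₂(g·u)`),
  then `Σ_σ F(σ)ν(σ) = c·Σ_g F(γ₀g⁻¹)L(g)` — EXACTLY: the `|G|` of Fourier inversion and the `|I|` of the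
  isotypic projector CANCEL (they are divided only inside the proof, in the value field).  No second
  («Coleman») measure, no separating family, no `E_θ`-convolution, no uniqueness of the L-measure is used
  (K49 / K51 / K53 / B66 untouched): ONE witness, ONE test function, type-θ data in, a μ-FREE number out.
* §C `charSum_smoothing` / `norm_sum_translate_sub_smul_le` — the smoothing `12(σ_𝔞⁻¹ − N𝔞)` done on the
  finite level (exact on the character side = the LHS of `CosetValueIdentity`; on the `F`-side up to the
  oscillation of `F`, ultrametric bound), and `sum_mul_apply_eq_sum_fiber` / `norm_fiberMass_le` (push the
  level-`N` masses of the witness forward to `G`; masses stay `≤ bound`).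
* §D `norm_le_of_transfer` — THE ASSEMBLY INEQUALITY: the four pieces and the two DIGITS give
  `‖∫ r·l dμ‖ ≤ 2^{−M/2}` from the ONE residual inequality `‖𝔖_m‖ ≤ ‖12(φ_𝔞 − N𝔞)‖·‖c‖⁻¹·2^{−M/2}`
  (`= 2^{−(M/2 + 2 + s_𝔞 + n/2)}`, `residual_iff_digits`, with the digits below) on the twisted regulator sum
  `𝔖_m = Σ_{g ∈ Gal(K(𝔣₀v̄^m vⁿ)/K)} F(γ₀g⁻¹)·log₂ j₂(g·u_m)`.
* §E `smoothing_digit` — the S⁻ digit as arithmetic: for odd `x, y`, `2 ∣ x − y`, and `4 ∤ x − y ↔ x ≢ y (4)`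
  (so `s_𝔞 := v₂(φ_𝔞 − N𝔞) ≥ 1` ALWAYS, `= 1` iff the residues mod `4` differ; the general digit `s` rides in
  `residual_iff_digits`, and because `μ(𝔣) = μ_𝔞/12(σ_𝔞 − N𝔞)` is `𝔞`-free no choice of `𝔞` is load-bearing).
* §F the `𝕜 = ℂ` and `𝕜 = ℂ_[2]` instances of §B (`isotypic_transfer_complex`, `isotypic_transfer_padicComplex`;
  `ℂ_[2]` = the certificate's value field, `HasEnoughRootsOfUnity` via `PadicComplex.isAlgClosed`).

NOT proved here (the card's typed sub-stubs; BSD is NOT proved by any of this, nor the crux, nor the stub):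
(S1) frame plumbing on the witness — Frobenius lift `ã` of `𝔞` at all levels (shape of `exists_frobLift`,
of record), level alignment `U_N ≤ ker(Γ_K → Gal(K(𝔤_m)/K))` (`SubgroupTower.exists_subset_of_isOpen` +
`rayKer_le_ker`, of record), `l` factors through `Gal(K(𝔤_m)/K)`, `(r·l)|_{I_v}` = a character `ϑ = θ⁻¹` of
EXACT level `n(key)` through `I` = image of inertia (CFT), oscillation `ε_m` of `r` on `Gal(K̄/K(𝔤_m))`;
(S2–S3) the coset hypothesis `hν` of §B read off `CosetValueIdentity` + (d1) + §C, with the Gauss-factor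
rigidity `gaussSumInv(χ) = c_n(χ|_I)·cval(χ γ̄₀)⁻¹` (definitional from the certificate's `gaussSumInv`);
(S4) an `I`-adapted section and the error budget fixing `m₀`; (T) THE SUBSTANCE —
`v₂(𝔖_{m₀}(𝔞)) ≥ M/2 + 2 + s_𝔞 + n/2` (Rubin-strength; EQUIVALENT to the receptacle given S1–S4; = road
RT⁺'s output re-typed μ-free and Coleman-free).
-/

noncomputable section

open Finset Filter
open scoped Topology

namespace Summit.BirchSwinnertonDyer.BirchSwinnertonDyer.Cruxes.SplitBadTwoLowerHalfOfFacts.LevelTransferK3G44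

/-! ## §A The level decides (ultrametric) -/

section LevelDecides

open Literature.NumberTheory.EllipticCurves

variable {Γ : Type*} [Group Γ] {𝒰 : SubgroupTower Γ} {𝕜 : Type*} [NormedField 𝕜] [IsUltrametricDist 𝕜]
variable [CompleteSpace 𝕜] (D : GroupDistribution 𝒰 𝕜)

omit [CompleteSpace 𝕜] in
/-- Ultrametric inequality for differences. [folklore] -/
theorem norm_sub_le_max' (x y : 𝕜) : ‖x - y‖ ≤ max ‖x‖ ‖y‖ := by
  simpa [sub_eq_add_neg, norm_neg] using IsUltrametricDist.norm_add_le_max x (-y)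

/-- **The level-`n` sum (any sample points) is within `bound·ε` of the integral** once `F` oscillates by
at most `ε` on the cells of every level `≥ N` and `N ≤ n`. [cite: deShalit1987, I.3.1 (p. 16)] -/
theorem norm_integral_sub_sum_le {f : Γ → 𝕜} (hf : 𝒰.IsTowerContinuous f) {ε : ℝ} (hε : 0 ≤ ε)
    {N : ℕ} (hN : ∀ n, N ≤ n → ∀ σ τ : Γ, 𝒰.proj n σ = 𝒰.proj n τ → ‖f σ - f τ‖ ≤ ε)
    {n : ℕ} (hn : N ≤ n) {x : Γ ⧸ 𝒰.U n → Γ} (hx : ∀ a, 𝒰.proj n (x a) = a) :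
    ‖D.integral f - ∑ a ∈ 𝒰.cells n, D.μ n a * f (x a)‖ ≤ D.bound * ε := by
  have h1 : ‖D.integral f - D.riemannSum f n‖ ≤ D.bound * ε := D.norm_integral_sub_riemannSum_le hf hε hN hn
  have h2 : ‖∑ a ∈ 𝒰.cells n, D.μ n a * f (x a) - D.riemannSum f n‖ ≤ D.bound * ε :=
    D.norm_sum_mul_apply_sub_riemannSum_le hε (hN n hn) hx
  calc ‖D.integral f - ∑ a ∈ 𝒰.cells n, D.μ n a * f (x a)‖
      = ‖(D.integral f - D.riemannSum f n) - (∑ a ∈ 𝒰.cells n, D.μ n a * f (x a) - D.riemannSum f n)‖ := by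
        congr 1; abel
    _ ≤ max ‖D.integral f - D.riemannSum f n‖ ‖∑ a ∈ 𝒰.cells n, D.μ n a * f (x a) - D.riemannSum f n‖ :=
        norm_sub_le_max' _ _
    _ ≤ D.bound * ε := max_le h1 h2

/-- **THE LEVEL DECIDES.**  With a threshold `R ≥ bound·ε`, the inequality `‖∫ F dD‖ ≤ R` on the
(infinite-order) integral is EQUIVALENT to the same inequality on the finite level-`n` sum with arbitrary
sample points — the receptacle's value statement becomes a statement about one finite sum.
[cite: deShalit1987, I.3.1 (p. 16)] -/
theorem norm_integral_le_iff_norm_sum_le {f : Γ → 𝕜} (hf : 𝒰.IsTowerContinuous f) {ε R : ℝ} (hε : 0 ≤ ε)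
    {N : ℕ} (hN : ∀ n, N ≤ n → ∀ σ τ : Γ, 𝒰.proj n σ = 𝒰.proj n τ → ‖f σ - f τ‖ ≤ ε)
    {n : ℕ} (hn : N ≤ n) {x : Γ ⧸ 𝒰.U n → Γ} (hx : ∀ a, 𝒰.proj n (x a) = a) (hR : D.bound * ε ≤ R) :
    ‖D.integral f‖ ≤ R ↔ ‖∑ a ∈ 𝒰.cells n, D.μ n a * f (x a)‖ ≤ R := by
  have h := (norm_integral_sub_sum_le D hf hε hN hn hx).trans hR
  constructor
  · intro hI
    calc ‖∑ a ∈ 𝒰.cells n, D.μ n a * f (x a)‖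
        = ‖D.integral f - (D.integral f - ∑ a ∈ 𝒰.cells n, D.μ n a * f (x a))‖ := by rw [sub_sub_cancel]
      _ ≤ max ‖D.integral f‖ ‖D.integral f - ∑ a ∈ 𝒰.cells n, D.μ n a * f (x a)‖ :=
          norm_sub_le_max' _ _
      _ ≤ R := max_le hI h
  · intro hS
    calc ‖D.integral f‖
        = ‖(D.integral f - ∑ a ∈ 𝒰.cells n, D.μ n a * f (x a)) + ∑ a ∈ 𝒰.cells n, D.μ n a * f (x a)‖ := by
          rw [sub_add_cancel]
      _ ≤ max ‖D.integral f - ∑ a ∈ 𝒰.cells n, D.μ n a * f (x a)‖ ‖∑ a ∈ 𝒰.cells n, D.μ n a * f (x a)‖ :=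
          IsUltrametricDist.norm_add_le_max _ _
      _ ≤ R := max_le h hS

omit [CompleteSpace 𝕜] in
/-- **Sample VALUES instead of sample points**: if `y a` is within `ε` of `f` at the representative of
the cell `a` (model: `y a = F(s(π a))` for a section `s` of `Γ_K → Gal(K(𝔤_m)/K)` — same fibre, so the
deviation is the oscillation of `r` on `Gal(K̄/K(𝔤_m))`), the `y`-sum is within `bound·ε` of the Riemann
sum. [cite: deShalit1987, I.3.1 (p. 16)] -/
theorem norm_sum_mul_sub_riemannSum_le {f : Γ → 𝕜} {ε : ℝ} (hε : 0 ≤ ε) {n : ℕ}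
    {y : Γ ⧸ 𝒰.U n → 𝕜} (hy : ∀ a, ‖y a - f (𝒰.repr n a)‖ ≤ ε) :
    ‖∑ a ∈ 𝒰.cells n, D.μ n a * y a - D.riemannSum f n‖ ≤ D.bound * ε := by
  rw [GroupDistribution.riemannSum_def, ← Finset.sum_sub_distrib]
  refine IsUltrametricDist.norm_sum_le_of_forall_le_of_nonneg (mul_nonneg D.bound_nonneg hε)
    fun a _ ↦ ?_
  rw [← mul_sub, norm_mul]
  exact mul_le_mul (D.norm_le n a) (hy a) (norm_nonneg _) D.bound_nonneg

/-- **THE LEVEL DECIDES, sampled form** (the form the cut consumes): with `R ≥ bound·ε`,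
`‖∫ F dD‖ ≤ R ↔ ‖Σ_a D_N(a)·y_a‖ ≤ R` for any values `y_a` within `ε` of `F` on the cells of a level
`n ≥ N` past the `ε`-oscillation level `N` of `F`. [cite: deShalit1987, I.3.1 (p. 16)] -/
theorem norm_integral_le_iff_norm_sampleSum_le {f : Γ → 𝕜} (hf : 𝒰.IsTowerContinuous f) {ε R : ℝ}
    (hε : 0 ≤ ε) {N : ℕ} (hN : ∀ n, N ≤ n → ∀ σ τ : Γ, 𝒰.proj n σ = 𝒰.proj n τ → ‖f σ - f τ‖ ≤ ε)
    {n : ℕ} (hn : N ≤ n) {y : Γ ⧸ 𝒰.U n → 𝕜} (hy : ∀ a, ‖y a - f (𝒰.repr n a)‖ ≤ ε)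
    (hR : D.bound * ε ≤ R) :
    ‖D.integral f‖ ≤ R ↔ ‖∑ a ∈ 𝒰.cells n, D.μ n a * y a‖ ≤ R := by
  have h1 : ‖D.integral f - D.riemannSum f n‖ ≤ D.bound * ε := D.norm_integral_sub_riemannSum_le hf hε hN hn
  have h2 := norm_sum_mul_sub_riemannSum_le D hε hy
  have h : ‖D.integral f - ∑ a ∈ 𝒰.cells n, D.μ n a * y a‖ ≤ R := by
    calc ‖D.integral f - ∑ a ∈ 𝒰.cells n, D.μ n a * y a‖
        = ‖(D.integral f - D.riemannSum f n) - (∑ a ∈ 𝒰.cells n, D.μ n a * y a - D.riemannSum f n)‖ := by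
          congr 1; abel
      _ ≤ max ‖D.integral f - D.riemannSum f n‖ ‖∑ a ∈ 𝒰.cells n, D.μ n a * y a - D.riemannSum f n‖ :=
          norm_sub_le_max' _ _
      _ ≤ R := (max_le h1 h2).trans hR
  constructor
  · intro hI
    calc ‖∑ a ∈ 𝒰.cells n, D.μ n a * y a‖
        = ‖D.integral f - (D.integral f - ∑ a ∈ 𝒰.cells n, D.μ n a * y a)‖ := by rw [sub_sub_cancel]
      _ ≤ max ‖D.integral f‖ ‖D.integral f - ∑ a ∈ 𝒰.cells n, D.μ n a * y a‖ := norm_sub_le_max' _ _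
      _ ≤ R := max_le hI h
  · intro hS
    calc ‖D.integral f‖
        = ‖(D.integral f - ∑ a ∈ 𝒰.cells n, D.μ n a * y a) + ∑ a ∈ 𝒰.cells n, D.μ n a * y a‖ := by
          rw [sub_add_cancel]
      _ ≤ max ‖D.integral f - ∑ a ∈ 𝒰.cells n, D.μ n a * y a‖ ‖∑ a ∈ 𝒰.cells n, D.μ n a * y a‖ :=
          IsUltrametricDist.norm_add_le_max _ _
      _ ≤ R := max_le h hS

end LevelDecides

/-! ## §B The θ-isotypic Fourier transfer on a finite abelian group (the new lever) -/

section IsotypicFourier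

variable {𝕜 : Type*} [Field 𝕜] [CharZero 𝕜]
variable {G : Type*} [CommGroup G] [Fintype G] [DecidableEq G]
variable [Fintype (G →* 𝕜ˣ)] [HasEnoughRootsOfUnity 𝕜 (Monoid.exponent G)]

omit [CharZero 𝕜] [DecidableEq G] in
/-- Column orthogonality: `Σ_χ χ(x) = 0` for `x ≠ 1` (duality gives `φ` with `φ x ≠ 1`; multiplication by
`φ` permutes the characters).  Generic-field form of the tree's `sum_monoidHom_apply_eq_zero` (Hodge
file, over `ℂ`). [cite: SerreLinearRepresentations1977, §2.6 Thm. 8] -/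
theorem sum_dual_apply_eq_zero {x : G} (hx : x ≠ 1) : ∑ χ : G →* 𝕜ˣ, (χ x : 𝕜) = 0 := by
  obtain ⟨φ, hφ⟩ := CommGroup.exists_apply_ne_one_of_hasEnoughRootsOfUnity G 𝕜 hx
  set S := ∑ χ : G →* 𝕜ˣ, (χ x : 𝕜) with hS_def
  have hS : (φ x : 𝕜) * S = S := by
    rw [hS_def, Finset.mul_sum]
    exact Fintype.sum_bijective (φ * ·) (Group.mulLeft_bijective φ) _ _ fun χ ↦ by
      rw [MonoidHom.mul_apply, Units.val_mul]
  have hφ' : (φ x : 𝕜) ≠ 1 := by rwa [Ne, Units.val_eq_one]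
  have h0 : ((φ x : 𝕜) - 1) * S = 0 := by rw [sub_mul, one_mul, hS, sub_self]
  rcases mul_eq_zero.mp h0 with h1 | h1
  · exact absurd (sub_eq_zero.mp h1) hφ'
  · exact h1

omit [CharZero 𝕜] in
/-- `Σ_χ χ(σ)·χ(τ)⁻¹ = |Ĝ|·[σ = τ]`. [cite: SerreLinearRepresentations1977, §2.6 Thm. 8] -/
theorem sum_dual_apply_mul_inv (σ τ : G) :
    ∑ χ : G →* 𝕜ˣ, (χ σ : 𝕜) * (χ τ : 𝕜)⁻¹ = if σ = τ then (Fintype.card (G →* 𝕜ˣ) : 𝕜) else 0 := by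
  have key : ∀ χ : G →* 𝕜ˣ, (χ σ : 𝕜) * (χ τ : 𝕜)⁻¹ = (χ (σ * τ⁻¹) : 𝕜) := fun χ ↦ by
    rw [map_mul, map_inv, Units.val_mul, Units.val_inv_eq_inv_val]
  simp_rw [key]
  split_ifs with h
  · subst h
    simp [Finset.card_univ]
  · exact sum_dual_apply_eq_zero (fun h' ↦ h (mul_inv_eq_one.mp h'))

/-- **Fourier injectivity**: a function all of whose character coefficients `Σ_σ χ(σ)⁻¹ f(σ)` vanish is
zero (`|Ĝ| ≠ 0` in characteristic `0`). [cite: SerreLinearRepresentations1977, §2.6 Thm. 8] -/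
theorem eq_zero_of_forall_charCoeff_eq_zero (f : G → 𝕜)
    (hf : ∀ χ : G →* 𝕜ˣ, ∑ σ, (χ σ : 𝕜)⁻¹ * f σ = 0) : f = 0 := by
  funext σ
  have h : ∑ χ : G →* 𝕜ˣ, (χ σ : 𝕜) * ∑ τ, (χ τ : 𝕜)⁻¹ * f τ = 0 := by simp [hf]
  have h' : ∑ χ : G →* 𝕜ˣ, (χ σ : 𝕜) * ∑ τ, (χ τ : 𝕜)⁻¹ * f τ =
      ∑ τ, f τ * ∑ χ : G →* 𝕜ˣ, (χ σ : 𝕜) * (χ τ : 𝕜)⁻¹ := by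
    simp_rw [Finset.mul_sum]
    rw [Finset.sum_comm]
    refine Finset.sum_congr rfl fun τ _ ↦ Finset.sum_congr rfl fun χ _ ↦ ?_
    ring
  rw [h'] at h
  simp_rw [sum_dual_apply_mul_inv] at h
  simp only [mul_ite, mul_zero, Finset.sum_ite_eq, Finset.mem_univ, if_true] at h
  have hcard : (Fintype.card (G →* 𝕜ˣ) : 𝕜) ≠ 0 := Nat.cast_ne_zero.mpr Fintype.card_ne_zero
  simpa [hcard] using h

variable (I : Subgroup G) [DecidablePred (· ∈ I)]

omit [CharZero 𝕜] [DecidableEq G] [Fintype (G →* 𝕜ˣ)] [HasEnoughRootsOfUnity 𝕜 (Monoid.exponent G)] in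
/-- Row orthogonality on the inertia subgroup against a type: `Σ_{h ∈ I} θ(h)⁻¹χ(h) = |I|` if `χ|_I = θ`,
`0` otherwise (Mathlib `sum_hom_units_eq_zero`). [cite: SerreLinearRepresentations1977, §2.6 Thm. 8] -/
theorem sum_inertia_typeRatio (θ : I →* 𝕜ˣ) (χ : G →* 𝕜ˣ) [Decidable (χ.comp I.subtype = θ)] :
    ∑ h : I, (θ h : 𝕜)⁻¹ * (χ (h : G) : 𝕜) =
      if χ.comp I.subtype = θ then (Fintype.card I : 𝕜) else 0 := by
  split_ifs with hc
  · have h1 : ∀ h : I, (θ h : 𝕜)⁻¹ * (χ (h : G) : 𝕜) = 1 := fun h ↦ by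
      have : χ (h : G) = θ h := by rw [← hc]; rfl
      rw [this, inv_mul_cancel₀ (Units.ne_zero _)]
    simp [h1, Finset.card_univ]
  · set ψ : I →* 𝕜ˣ := θ⁻¹ * χ.comp I.subtype with hψ_def
    have hψ : ∀ h : I, (θ h : 𝕜)⁻¹ * (χ (h : G) : 𝕜) = ((Units.coeHom 𝕜).comp ψ) h := fun h ↦ by
      simp [hψ_def, Units.val_mul]
    have hne : (Units.coeHom 𝕜).comp ψ ≠ 1 := by
      intro h1
      apply hc
      ext h
      have h2 : (θ h : 𝕜)⁻¹ * (χ (h : G) : 𝕜) = 1 := by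
        rw [hψ h, h1, MonoidHom.one_apply]
      have hθ : (θ h : 𝕜) ≠ 0 := Units.ne_zero _
      have h3 : (χ (h : G) : 𝕜) = (θ h : 𝕜) := by
        have := congrArg ((θ h : 𝕜) * ·) h2
        simpa [← mul_assoc, mul_inv_cancel₀ hθ] using this
      simp only [MonoidHom.coe_comp, Subgroup.coe_subtype, Function.comp_apply]
      exact h3
    simp_rw [hψ]
    exact sum_hom_units_eq_zero _ hne

/-- **THE θ-ISOTYPIC FOURIER TRANSFER** (the glue of the cut, division-free in its statement).
`G` = `Gal(K(𝔣₀v̄^m vⁿ)/K)`, `I` = inertia at `v` (`= Gal(K(𝔣₀v̄^m vⁿ)/K(𝔣₀v̄^m))`), `θ` = the frame's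
type, `F` = the frame integrand `r·θ̂_K⁻¹` sampled on `G` through an `I`-equivariant section (type `θ⁻¹`),
`ν` = the smoothed level masses of the witness, `L g = log₂ j₂(g·u_m)`, `c·χ(γ₀)⁻¹` = `G(χ⁻¹)` for the
type-`θ` characters, so `hν` is `CosetValueIdentity` summed over the level (II.5.2 (4)).  Conclusion: the
`F`-weighted mass sum IS `c` times the `F`-twisted regulator sum of ONE elliptic unit — no `|G|`, no `|I|`,
no second measure. [cite: deShalit1987, II.5.2 (4) (p. 79), II.4.12 (31)–(33) (p. 66–68)] -/
theorem isotypic_transfer (θ : I →* 𝕜ˣ) (F ν L : G → 𝕜) (c : 𝕜) (γ₀ : G)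
    (hF : ∀ (h : I) (σ : G), F ((h : G) * σ) = (θ h : 𝕜)⁻¹ * F σ)
    (hν : ∀ χ : G →* 𝕜ˣ, χ.comp I.subtype = θ →
      ∑ σ, (χ σ : 𝕜)⁻¹ * ν σ = c * (χ γ₀ : 𝕜)⁻¹ * ∑ g, (χ g : 𝕜) * L g) :
    ∑ σ, F σ * ν σ = c * ∑ g, F (γ₀ * g⁻¹) * L g := by
  classical
  -- the reindexing involution `g ↦ γ₀ g⁻¹`
  have h1 : ∀ g : G, γ₀ * (γ₀ * g⁻¹)⁻¹ = g := fun g ↦ by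
    rw [mul_inv_rev, inv_inv, mul_comm g, mul_inv_cancel_left]
  have hinv : Function.Involutive (fun g : G ↦ γ₀ * g⁻¹) := fun g ↦ h1 g
  -- the model masses `ρ τ = c · L(γ₀ τ⁻¹)`
  set ρ : G → 𝕜 := fun τ ↦ c * L (γ₀ * τ⁻¹) with hρ_def
  have hρg : ∀ g : G, ρ (γ₀ * g⁻¹) = c * L g := fun g ↦ by
    show c * L (γ₀ * (γ₀ * g⁻¹)⁻¹) = c * L g
    rw [h1]
  have hχg : ∀ (χ : G →* 𝕜ˣ) (g : G), (χ (γ₀ * g⁻¹) : 𝕜)⁻¹ = (χ γ₀ : 𝕜)⁻¹ * (χ g : 𝕜) := fun χ g ↦ by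
    rw [map_mul, map_inv, Units.val_mul, Units.val_inv_eq_inv_val, mul_inv, inv_inv]
  have hρ : ∀ χ : G →* 𝕜ˣ,
      ∑ σ, (χ σ : 𝕜)⁻¹ * ρ σ = c * (χ γ₀ : 𝕜)⁻¹ * ∑ g, (χ g : 𝕜) * L g := by
    intro χ
    rw [Finset.mul_sum]
    refine (Function.Bijective.sum_comp hinv.bijective (fun σ ↦ (χ σ : 𝕜)⁻¹ * ρ σ)).symm.trans ?_
    refine Finset.sum_congr rfl fun g _ ↦ ?_
    rw [hχg, hρg]
    ring
  -- `D = ν − ρ` has vanishing coefficients at the type-`θ` characters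
  have hD : ∀ χ : G →* 𝕜ˣ, χ.comp I.subtype = θ → ∑ σ, (χ σ : 𝕜)⁻¹ * (ν σ - ρ σ) = 0 := by
    intro χ hχ
    simp only [mul_sub, Finset.sum_sub_distrib, hν χ hχ, hρ χ, sub_self]
  -- its `θ`-projection `Dθ σ = Σ_{h ∈ I} θ(h)⁻¹ D(hσ)` has ALL coefficients zero, hence vanishes
  set Dθ : G → 𝕜 := fun σ ↦ ∑ h : I, (θ h : 𝕜)⁻¹ * (ν ((h : G) * σ) - ρ ((h : G) * σ)) with hDθ_def
  have hcoeff : ∀ χ : G →* 𝕜ˣ, ∑ σ, (χ σ : 𝕜)⁻¹ * Dθ σ = 0 := by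
    intro χ
    have hswap : ∑ σ, (χ σ : 𝕜)⁻¹ * Dθ σ =
        ∑ h : I, (θ h : 𝕜)⁻¹ * (χ (h : G) : 𝕜) * ∑ τ, (χ τ : 𝕜)⁻¹ * (ν τ - ρ τ) := by
      simp only [hDθ_def, Finset.mul_sum]
      rw [Finset.sum_comm]
      refine Finset.sum_congr rfl fun h _ ↦ ?_
      -- reindex `τ = h σ`
      refine (Fintype.sum_bijective (fun σ ↦ (h : G) * σ) (Group.mulLeft_bijective (h : G)) _ _ fun σ ↦ ?_)
      have hχ : (χ ((h : G) * σ) : 𝕜)⁻¹ = (χ (h : G) : 𝕜)⁻¹ * (χ σ : 𝕜)⁻¹ := by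
        rw [map_mul, Units.val_mul, mul_inv]
      rw [hχ]
      have hh : (χ (h : G) : 𝕜) * (χ (h : G) : 𝕜)⁻¹ = 1 := mul_inv_cancel₀ (Units.ne_zero _)
      linear_combination
        (-((θ h : 𝕜)⁻¹ * (χ σ : 𝕜)⁻¹ * (ν ((h : G) * σ) - ρ ((h : G) * σ)))) * hh
    rw [hswap, ← Finset.sum_mul, sum_inertia_typeRatio I θ χ]
    split_ifs with hχ
    · rw [hD χ hχ, mul_zero]
    · rw [zero_mul]
  have hDθ0 : Dθ = 0 := eq_zero_of_forall_charCoeff_eq_zero Dθ hcoeff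
  -- `|I| · Σ F·D = Σ F·Dθ = 0`
  have hT : (Fintype.card I : 𝕜) * ∑ σ, F σ * (ν σ - ρ σ) = ∑ σ, F σ * Dθ σ := by
    have step : ∀ h : I, ∑ σ, F σ * (ν σ - ρ σ) =
        ∑ σ, (θ h : 𝕜)⁻¹ * F σ * (ν ((h : G) * σ) - ρ ((h : G) * σ)) := by
      intro h
      symm
      refine Fintype.sum_bijective (fun σ ↦ (h : G) * σ) (Group.mulLeft_bijective (h : G)) _ _ fun σ ↦ ?_
      rw [hF h σ]
    calc (Fintype.card I : 𝕜) * ∑ σ, F σ * (ν σ - ρ σ)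
        = ∑ h : I, ∑ σ, F σ * (ν σ - ρ σ) := by simp [Finset.card_univ]
      _ = ∑ h : I, ∑ σ, (θ h : 𝕜)⁻¹ * F σ * (ν ((h : G) * σ) - ρ ((h : G) * σ)) :=
          Finset.sum_congr rfl fun h _ ↦ step h
      _ = ∑ σ, F σ * Dθ σ := by
          rw [Finset.sum_comm]
          refine Finset.sum_congr rfl fun σ _ ↦ ?_
          simp only [hDθ_def, Finset.mul_sum]
          refine Finset.sum_congr rfl fun h _ ↦ ?_
          ring
  have hI : (Fintype.card I : 𝕜) ≠ 0 := Nat.cast_ne_zero.mpr Fintype.card_ne_zero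
  have hT0 : ∑ σ, F σ * (ν σ - ρ σ) = 0 := by
    have : (Fintype.card I : 𝕜) * ∑ σ, F σ * (ν σ - ρ σ) = 0 := by
      rw [hT, hDθ0]; simp
    exact (mul_eq_zero.mp this).resolve_left hI
  have hνρ : ∑ σ, F σ * ν σ = ∑ σ, F σ * ρ σ := by
    simpa [mul_sub, Finset.sum_sub_distrib, sub_eq_zero] using hT0
  -- conclude by the same reindexing
  rw [hνρ, Finset.mul_sum]
  refine (Function.Bijective.sum_comp hinv.bijective (fun σ ↦ F σ * ρ σ)).symm.trans ?_
  refine Finset.sum_congr rfl fun g _ ↦ ?_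
  rw [hρg]
  ring

end IsotypicFourier

/-! ## §C Smoothing and push-forward on the finite level -/

section Smoothing

variable {𝕜 : Type*} [Field 𝕜] {G : Type*} [CommGroup G] [Fintype G]

/-- **Smoothing on the character side is exact**: for the translated-and-scaled masses
`ν g = w·(μ̄(a⁻¹g) − N·μ̄ g)` (`w = 12`, `a = σ_𝔞`, `N = N𝔞`),
`Σ_g χ(g)⁻¹ ν(g) = w·(χ(a)⁻¹ − N)·Σ_g χ(g)⁻¹ μ̄(g)` — the left-hand side of `CosetValueIdentity`
(`12·(χ(σ_𝔞)⁻¹ − N𝔞)·∫χ̂⁻¹dμ`) read on level masses. [cite: deShalit1987, II.4.12 (p. 67–69), II.5.2 (4) (p. 79)] -/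
theorem charSum_smoothing (μbar : G → 𝕜) (a : G) (w N : 𝕜) (χ : G →* 𝕜ˣ) :
    ∑ g, (χ g : 𝕜)⁻¹ * (w * (μbar (a⁻¹ * g) - N * μbar g)) =
      w * ((χ a : 𝕜)⁻¹ - N) * ∑ g, (χ g : 𝕜)⁻¹ * μbar g := by
  classical
  have h1 : ∑ g, (χ g : 𝕜)⁻¹ * μbar (a⁻¹ * g) = (χ a : 𝕜)⁻¹ * ∑ g, (χ g : 𝕜)⁻¹ * μbar g := by
    rw [Finset.mul_sum]
    refine (Fintype.sum_bijective (fun g ↦ a * g) (Group.mulLeft_bijective a) _ _ fun g ↦ ?_).symm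
    rw [inv_mul_cancel_left, map_mul, Units.val_mul, mul_inv]
    ring
  have h2 : ∑ g, (χ g : 𝕜)⁻¹ * (w * (μbar (a⁻¹ * g) - N * μbar g)) =
      w * ∑ g, (χ g : 𝕜)⁻¹ * μbar (a⁻¹ * g) - w * N * ∑ g, (χ g : 𝕜)⁻¹ * μbar g := by
    simp only [mul_sub, Finset.sum_sub_distrib, Finset.mul_sum]
    congr 1 <;> refine Finset.sum_congr rfl fun g _ ↦ by ring
  rw [h2, h1]
  ring

/-- **Push-forward of level masses along the fibres**: a weighted sum whose weight-function factors
through `p : A → Q` is the sum over `Q` against the fibre masses `Σ_{p a = q} w a`. [folklore] -/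
theorem sum_mul_apply_eq_sum_fiber {A Q : Type*} [Fintype A] [Fintype Q] [DecidableEq Q]
    (w : A → 𝕜) (p : A → Q) (φ : Q → 𝕜) :
    ∑ a, w a * φ (p a) = ∑ q, (∑ a ∈ Finset.univ.filter (fun a ↦ p a = q), w a) * φ q := by
  rw [← Finset.sum_fiberwise_of_maps_to (s := Finset.univ) (t := Finset.univ) (g := p) (fun a _ ↦ Finset.mem_univ _)]
  refine Finset.sum_congr rfl fun q _ ↦ ?_
  rw [Finset.sum_mul]
  refine Finset.sum_congr rfl fun a ha ↦ ?_
  rw [(Finset.mem_filter.mp ha).2]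

end Smoothing

section SmoothingNorm

variable {𝕜 : Type*} [NormedField 𝕜] [IsUltrametricDist 𝕜] {G : Type*} [CommGroup G] [Fintype G]

/-- **Fibre masses stay bounded** (ultrametric): if every level mass has norm `≤ B` then so does every
fibre mass `Σ_{p a = q} w a`. [cite: deShalit1987, I.3.1 (p. 16)] -/
theorem norm_fiberMass_le {A Q : Type*} [Fintype A] [DecidableEq Q] (w : A → 𝕜) (p : A → Q) {B : ℝ}
    (hB : 0 ≤ B) (hw : ∀ a, ‖w a‖ ≤ B) (q : Q) :
    ‖∑ a ∈ Finset.univ.filter (fun a ↦ p a = q), w a‖ ≤ B :=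
  IsUltrametricDist.norm_sum_le_of_forall_le_of_nonneg hB fun a _ ↦ hw a

/-- **Smoothing on the `F`-side costs only the oscillation of `F`**: if `F(a·g) = φ·F(g)` up to `ε`
(for the frame integrand sampled through a section: `φ = (r·l)(ã)`, `ε` = oscillation of `r` on the
level's cells) and the masses are `≤ B`, then
`‖Σ_g F(g)·μ̄(a⁻¹g) − φ·Σ_g F(g)·μ̄(g)‖ ≤ ε·B`. [cite: deShalit1987, I.3.1 (p. 16), II.4.12 (p. 67)] -/
theorem norm_sum_translate_sub_smul_le (F μbar : G → 𝕜) (a : G) (φ : 𝕜) {ε B : ℝ} (hε : 0 ≤ ε)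
    (hB : 0 ≤ B) (hF : ∀ g, ‖F (a * g) - φ * F g‖ ≤ ε) (hμ : ∀ g, ‖μbar g‖ ≤ B) :
    ‖∑ g, F g * μbar (a⁻¹ * g) - φ * ∑ g, F g * μbar g‖ ≤ ε * B := by
  classical
  have h1 : ∑ g, F g * μbar (a⁻¹ * g) = ∑ g, F (a * g) * μbar g :=
    (Fintype.sum_bijective (fun g ↦ a * g) (Group.mulLeft_bijective a) _ _ fun g ↦ by
      rw [inv_mul_cancel_left]).symm
  rw [h1, Finset.mul_sum, ← Finset.sum_sub_distrib]
  refine IsUltrametricDist.norm_sum_le_of_forall_le_of_nonneg (mul_nonneg hε hB) fun g _ ↦ ?_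
  rw [show F (a * g) * μbar g - φ * (F g * μbar g) = (F (a * g) - φ * F g) * μbar g by ring, norm_mul]
  exact mul_le_mul (hF g) (hμ g) (norm_nonneg _) hε

end SmoothingNorm

/-! ## §D The assembly inequality -/

section Assembly

variable {𝕜 : Type*} [NormedField 𝕜] [IsUltrametricDist 𝕜]

/-- **THE ASSEMBLY (glue of the four pieces, ultrametric).**  `Iv = ∫ r·l dμ`; `S₁` = the level sum of
`r·l` against the witness's pushed-forward masses (§A: `‖Iv − S₁‖ ≤ R`); `S₂` = the same sum against the
smoothed masses, `S₂ = κ·S₁ + E` with `κ = 12(φ_𝔞 − N𝔞) ≠ 0` and `‖E‖ ≤ ‖κ‖·R` (§C);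
`S₂ = c·𝔖` (§B, `c` = Gauss constant, `𝔖` = twisted regulator sum).  Then the ONE residual inequality
`‖c·𝔖‖ ≤ ‖κ‖·R` gives `‖Iv‖ ≤ R`. [cite: deShalit1987, II.5.2 (4) (p. 79)] -/
theorem norm_le_of_transfer {Iv S₁ S₂ E 𝔖 κ c : 𝕜} {R : ℝ} (hκ : κ ≠ 0)
    (h1 : ‖Iv - S₁‖ ≤ R) (h2 : S₂ = κ * S₁ + E) (h3 : ‖E‖ ≤ ‖κ‖ * R) (h4 : S₂ = c * 𝔖)
    (h5 : ‖c * 𝔖‖ ≤ ‖κ‖ * R) : ‖Iv‖ ≤ R := by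
  have hκn : 0 < ‖κ‖ := norm_pos_iff.mpr hκ
  have hS₁ : S₁ = κ⁻¹ * (S₂ - E) := by
    rw [h2]; field_simp; ring
  have hS₁n : ‖S₁‖ ≤ R := by
    rw [hS₁, norm_mul, norm_inv]
    have : ‖S₂ - E‖ ≤ ‖κ‖ * R :=
      (norm_sub_le_max' _ _).trans (max_le (h4 ▸ h5) h3)
    calc ‖κ‖⁻¹ * ‖S₂ - E‖ ≤ ‖κ‖⁻¹ * (‖κ‖ * R) := by gcongr
      _ = R := by field_simp
  calc ‖Iv‖ = ‖(Iv - S₁) + S₁‖ := by rw [sub_add_cancel]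
    _ ≤ max ‖Iv - S₁‖ ‖S₁‖ := IsUltrametricDist.norm_add_le_max _ _
    _ ≤ R := max_le h1 hS₁n

omit [IsUltrametricDist 𝕜] in
/-- **Digit bookkeeping** (general smoothing digit `s = v₂(φ_𝔞 − N𝔞) ≥ 1`): with
`‖κ‖ = 2^{−(2 + s)}` (`v₂ 12 = 2` plus `s`) and `‖c‖ = 2^{n/2}` (the tree's Gauss digit
`‖gaussSumInv‖ = 2^{n/2}`), the residual inequality `‖c·𝔖‖ ≤ ‖κ‖·2^{−M/2}` is
`‖𝔖‖ ≤ 2^{−(M/2 + 2 + s + n/2)}`.  Since de Shalit's `μ(𝔣) = μ_𝔞 / 12(σ_𝔞 − N𝔞)` is `𝔞`-free, the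
threshold's `𝔞`-dependence through `s` is exactly compensated inside `𝔖 = 𝔖(𝔞)`: no Chebotarev choice is
load-bearing. [cite: deShalit1987, II.4.8 (19), II.4.12 (31), II.5.2 (4) (p. 79)] -/
theorem residual_iff_digits {𝔖 κ c : 𝕜} {M n s : ℝ} (hκ : ‖κ‖ = (2 : ℝ) ^ (-(2 + s)))
    (hc : ‖c‖ = (2 : ℝ) ^ (n / 2)) :
    ‖c * 𝔖‖ ≤ ‖κ‖ * (2 : ℝ) ^ (-M / 2) ↔ ‖𝔖‖ ≤ (2 : ℝ) ^ (-(M / 2 + 2 + s + n / 2)) := by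
  have h2 : (0 : ℝ) < 2 := by norm_num
  have hcpos : 0 < (2 : ℝ) ^ (n / 2) := Real.rpow_pos_of_pos h2 _
  rw [norm_mul, hc, hκ]
  rw [show (2 : ℝ) ^ (-(M / 2 + 2 + s + n / 2))
      = (2 : ℝ) ^ (-(2 + s)) * (2 : ℝ) ^ (-M / 2) / (2 : ℝ) ^ (n / 2) by
    rw [← Real.rpow_add h2, ← Real.rpow_sub h2]; congr 1; ring]
  rw [le_div_iff₀ hcpos, mul_comm]

omit [IsUltrametricDist 𝕜] in
/-- The generic case `s = 1` (`φ_𝔞 ≢ N𝔞 mod 4`): threshold `M/2 + 3 + n/2`. -/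
theorem residual_iff_digits_one {𝔖 κ c : 𝕜} {M n : ℝ} (hκ : ‖κ‖ = (2 : ℝ) ^ (-(3 : ℝ)))
    (hc : ‖c‖ = (2 : ℝ) ^ (n / 2)) :
    ‖c * 𝔖‖ ≤ ‖κ‖ * (2 : ℝ) ^ (-M / 2) ↔ ‖𝔖‖ ≤ (2 : ℝ) ^ (-(M / 2 + 3 + n / 2)) := by
  have h := residual_iff_digits (𝔖 := 𝔖) (M := M) (n := n) (s := 1) (by rw [hκ]; norm_num) hc
  rw [show -(M / 2 + 2 + 1 + n / 2) = -(M / 2 + 3 + n / 2) by ring] at h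
  exact h

end Assembly

/-! ## §E The smoothing digit as arithmetic -/

section Digit

/-- **The S⁻ digit.**  `φ_𝔞 = (r·l)(Frob_𝔞) = ι((ψ_W^c)⁻¹(𝔞))` is a `2`-adic unit and `N𝔞` is odd, so
`v₂(φ_𝔞 − N𝔞) ≥ 1` always; reading both in `ℤ/4` (`𝒪_{K,v}/4 = ℤ/4` at the split prime) the valuation is
EXACTLY `1` iff the residues mod `4` differ (support (P2): decidable per key; NOT load-bearing — the general
digit `s` rides in `residual_iff_digits`).
The arithmetic content, over `ℤ`: [folklore] -/
theorem smoothing_digit (x y : ℤ) (hx : Odd x) (hy : Odd y) :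
    2 ∣ x - y ∧ (¬ 4 ∣ x - y ↔ ¬ x ≡ y [ZMOD 4]) := by
  refine ⟨?_, ?_⟩
  · obtain ⟨a, rfl⟩ := hx
    obtain ⟨b, rfl⟩ := hy
    exact ⟨a - b, by ring⟩
  · rw [Int.modEq_iff_dvd, dvd_sub_comm]

/-- …and the two cases are the only ones: for odd `x, y`, `x − y ≡ 0` or `2 (mod 4)`. [folklore] -/
theorem smoothing_digit_cases (x y : ℤ) (hx : Odd x) (hy : Odd y) :
    4 ∣ x - y ∨ (x - y) % 4 = 2 := by
  obtain ⟨a, rfl⟩ := hx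
  obtain ⟨b, rfl⟩ := hy
  have : (2 * a + 1 - (2 * b + 1)) = 2 * (a - b) := by ring
  rw [this]
  rcases Int.even_or_odd (a - b) with ⟨k, hk⟩ | ⟨k, hk⟩
  · left; exact ⟨k, by rw [hk]; ring⟩
  · right; rw [hk]; omega

end Digit

/-! ## §F The `ℂ`-valued instance of §B (the currency of `IsCosetValues`: `χ : Gal → ℂˣ`, values moved by `cval ι`) -/

section ComplexInstance

variable {G : Type*} [CommGroup G] [Fintype G] [DecidableEq G] [Fintype (G →* ℂˣ)]

/-- §B over `ℂ`: Mathlib's `HasEnoughRootsOfUnity ℂ (exponent G)` instance (algebraically closed,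
characteristic zero) discharges the duality hypothesis. [cite: SerreLinearRepresentations1977, §2.6 Thm. 8] -/
theorem isotypic_transfer_complex (I : Subgroup G) [DecidablePred (· ∈ I)] (θ : I →* ℂˣ)
    (F ν L : G → ℂ) (c : ℂ) (γ₀ : G)
    (hF : ∀ (h : I) (σ : G), F ((h : G) * σ) = (θ h : ℂ)⁻¹ * F σ)
    (hν : ∀ χ : G →* ℂˣ, χ.comp I.subtype = θ →
      ∑ σ, (χ σ : ℂ)⁻¹ * ν σ = c * (χ γ₀ : ℂ)⁻¹ * ∑ g, (χ g : ℂ) * L g) :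
    ∑ σ, F σ * ν σ = c * ∑ g, F (γ₀ * g⁻¹) * L g :=
  isotypic_transfer I θ F ν L c γ₀ hF hν

end ComplexInstance

section PadicComplexInstance

variable {G : Type*} [CommGroup G] [Fintype G] [DecidableEq G] [Fintype (G →* ℂ_[2]ˣ)]

/-- §B over `ℂ₂` (the value field of the certificate: `cval ι ∘ χ`, `galCharInv`, `unitLogSum` are
`ℂ_[2]`-valued): `ℂ_[2]` is algebraically closed of characteristic `0`, so the duality hypothesis is
discharged once `exponent G ≠ 0` is registered. [cite: SerreLinearRepresentations1977, §2.6 Thm. 8] -/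
theorem isotypic_transfer_padicComplex (I : Subgroup G) [DecidablePred (· ∈ I)] (θ : I →* ℂ_[2]ˣ)
    (F ν L : G → ℂ_[2]) (c : ℂ_[2]) (γ₀ : G)
    (hF : ∀ (h : I) (σ : G), F ((h : G) * σ) = (θ h : ℂ_[2])⁻¹ * F σ)
    (hν : ∀ χ : G →* ℂ_[2]ˣ, χ.comp I.subtype = θ →
      ∑ σ, (χ σ : ℂ_[2])⁻¹ * ν σ = c * (χ γ₀ : ℂ_[2])⁻¹ * ∑ g, (χ g : ℂ_[2]) * L g) :
    ∑ σ, F σ * ν σ = c * ∑ g, F (γ₀ * g⁻¹) * L g := by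
  haveI : NeZero ((Monoid.exponent G : ℕ) : ℂ_[2]) :=
    ⟨Nat.cast_ne_zero.mpr Monoid.exponent_ne_zero_of_finite⟩
  exact isotypic_transfer I θ F ν L c γ₀ hF hν

end PadicComplexInstance

end Summit.BirchSwinnertonDyer.BirchSwinnertonDyer.Cruxes.SplitBadTwoLowerHalfOfFacts.LevelTransferK3G44

end
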